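import Summits.QuantumFields.YangMills.Theorems.BalabanUVNodesN15KingModelToronEffectiveRate
import HarnessLib

/-!
# BalabanUVNodes ∕ N15 — THE KING-MODEL RUNG (PART Ͷ-n): THE UNIT-LATTICE (BLOCK-FIELD) COVARIANCE AT A TORON — `(Δ^ω_eff)⁻¹ = a⁻¹·1 + Q^ωB_ω⁻¹Q^{ω*}` (block-spin white noise plus the
# covariantly block-averaged toron covariance), its Fourier multiplier `a⁻¹ + Σ_l|u(s′+l)|²∕Δ^η(s′+l)` = King's `composedInvResc` at the shifted momentum, and its relative `L^{−2k}` rate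
# (Track A, DAG node N15 = NE2 «η-rates of the covariance pieces»; FAN-OUT v1.1 §N15 s3 «KING-MODEL RUNG … NE2's analogue DECIDED in the model … + what the curved case adds»; count-neutral)

HONEST FRAMING.  Count-neutral (cell `pub-ymgap`, seat `pub-ymgap-dag-n15-e` g44; `--supports stmt-QuantumFields-27247 --as helper` = K3ᴬ, KEY MAP v3).  King's scalar block-spin
model [King1986] with the covariant block mean at a constant abelian (flat) link field (PARTS Ͷ-k∕Ͷ-l); the `A = 0` statement is the tree's PART Ϛ `effLaplacian_inv_eq_noise_add_blockAvg`
(`(Δ^{(K)})⁻¹ = a⁻¹·1 + N^d·QB⁻¹Qᵀ`, King (2.13)–(2.15) p.653 ∕ (4.44) p.675).  NE2's UNIT LAYER in the model is this kernel; here it is typed at a live flat `U`.  NOT Bałaban's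
`C^{(k)}(Λ)` of [Balaban1985BackgroundPropagators] (3.185)–(3.187); NOT a node discharge; nothing continuum-YM ∕ ℝ⁴ ∕ OS ∕ Clay.

THE RESULTS (`a > 0`, `m² > 0`, `c ≥ 0`, unit `ω`; `Δ^ω_eff = effLapTw N M a c m² ω`, `B_ω = toronOp (fine N M) c m² ω`, `Q^{ω*} = kingQadjTw`):
* §1 `noisePlusSandwich_eq_spectral`, `isUnit_noisePlusSandwich`, ★★★ **`effLapTw_inv_eq_noise_add_blockAvg`** — `(Δ^ω_eff)⁻¹ = a⁻¹·1 + Q^ωB_ω⁻¹Q^{ω*}`: THE BLOCK-FIELD COVARIANCE AT A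
  TORON IS THE BLOCK-SPIN WHITE NOISE (holonomy-blind) PLUS THE COVARIANTLY BLOCK-AVERAGED TORON COVARIANCE; `isUnit_effLapTw`; ★★ `dft_effLapTw_inv_apply` (multiplier `a⁻¹ + sigTw(p′)`);
* §2 at `ω = e^{iφ}`, `c = N²`, on the zone of `s′ = p′ + Nφ`: ★★ **`dft_effLapTw_inv_apply_eq_composedInvResc`** — the multiplier IS King's `composedInvResc a⁻¹ N m² s′ = a⁻¹ +
  Σ_l Ur(s′,l)·Δ^η(s′+l)⁻¹` (the tree's (4.5)∕(4.12) letters) at the SHIFTED momentum; `toronBlockCovSymbol` and its bounds `a_k⁻¹ ≤ C^{(k)}_ω(p′)` ∕ positivity;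
* §3 ★★★ **`king_blockCov_rate_toron`** — THE RELATIVE `L^{−2k}` RATE OF THE UNIT-LATTICE COVARIANCE AT A TORON (same holonomy at both levels, King's constants):
  `|C^{(k)}_ω(p′) − C^{(k+n)}_{ω′}(p′)| ≤ a_k·2(a_n⁻¹ + π²∕48 + 1∕3)·L^{−2k}·C^{(k+n)}_{ω′}(p′)` (`C = 1∕Δ`; from PART Ͷ-l's Lemma 4.3 at `s′`).

PRIOR TREE ART (by name): Ͷ-k (`effLapTw`, `effLapTw_eq_inv`, `sandwichTw_eq_spectral`, `sigTw`, `inv_add_sigTw_ne_zero`, `effLapTw_symbol_eq_DeltaEff`, `kingQadjTw`), Ͷ-l (`toronEffSymbol`,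
`king_lemma43_toron`, `king_prop310_toron_uniform`, `sOfTw_refine`), `King1986` (`DeltaEff`, `composedInvResc`, `aK`, `aK_pos`), `B5LaplaceInverse` (`dft_conjTranspose_mul`,
`dft_mul_conjTranspose`).  Dedup (rg at filing): basename 0 files; needles `effLapTw_inv_eq_noise_add_blockAvg|toronBlockCovSymbol|king_blockCov_rate_toron|noisePlusSandwich` 0 tree files.
Locators: [King1986] (2.13)–(2.15) p.653, (4.44) p.675, (4.5) p.670, (4.12) p.671, Lemma 4.5 (4.38) p.674 (the position-space form, NOT typed here), Prop. 3.10 (3.91) p.669;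
[Balaban1985BackgroundPropagators] (3.19) p.393; [tHooft1979Flux] NPB 153 (notion only).  0 `sorry`, 1 `def`.
-/

noncomputable section

open scoped BigOperators ComplexConjugate
open Finset Matrix Complex

namespace Summit.QuantumFields.YangMills.BalabanUVNodes.N15KingModelRung.Toron

open Literature.MathematicalPhysics.QuantumFieldTheory.Balaban1983to89.B5Prop11Plancherel
open Literature.MathematicalPhysics.QuantumFieldTheory.Balaban1983to89.B5LaplaceInverse (dft_conjTranspose_mul dft_mul_conjTranspose)
open Literature.MathematicalPhysics.QuantumFieldTheory.Balaban1983to89.B5ToronOperators118 (QsOpTw)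
open Literature.MathematicalPhysics.QuantumFieldTheory.Balaban1983to89.B5ToronMomentum161 (sOfTw twistOf)
open Literature.MathematicalPhysics.QuantumFieldTheory.King1986 (DeltaEff composedInvResc aK aK_pos momSq)

variable {d : ℕ} (N : ℕ) [NeZero N] (M : Fin (d + 1) → ℕ) [hM : ∀ μ, NeZero (M μ)]

/-! ## §1 `(Δ^ω_eff)⁻¹ = a⁻¹·1 + Q^ωB_ω⁻¹Q^{ω*}` -/
section Inverse

/-- The noise-plus-sandwich operator is the Fourier multiplier `a⁻¹ + sigTw`. [cite: King1986, (4.5) p.670] -/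
theorem noisePlusSandwich_eq_spectral {a c m2 : ℝ} (hc : 0 ≤ c) (hm : 0 < m2) {ω : Fin (d + 1) → ℂ} (hω : ∀ μ, ‖ω μ‖ = 1) :
    ((a : ℂ)⁻¹) • (1 : Matrix (Tor M) (Tor M) ℂ) + QsOpTw N M ω * (toronOp (fine N M) c m2 ω)⁻¹ * kingQadjTw N M ω
      = (dft M)ᴴ * Matrix.diagonal (fun q => (a : ℂ)⁻¹ + sigTw N M c m2 ω q) * dft M := by
  rw [sandwichTw_eq_spectral N M hc hm hω]
  have h1 : ((a : ℂ)⁻¹) • (1 : Matrix (Tor M) (Tor M) ℂ) = (dft M)ᴴ * Matrix.diagonal (fun _ => (a : ℂ)⁻¹) * dft M := by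
    rw [← Matrix.smul_one_eq_diagonal, Matrix.mul_smul, Matrix.mul_one, Matrix.smul_mul, dft_conjTranspose_mul]
  rw [h1, ← Matrix.add_mul, ← Matrix.mul_add, Matrix.diagonal_add]

/-- The noise-plus-sandwich operator is invertible (`a > 0`, `m² > 0`, `c ≥ 0`). [folklore] -/
theorem isUnit_noisePlusSandwich {a c m2 : ℝ} (ha : 0 < a) (hc : 0 ≤ c) (hm : 0 < m2) {ω : Fin (d + 1) → ℂ} (hω : ∀ μ, ‖ω μ‖ = 1) :
    IsUnit (((a : ℂ)⁻¹) • (1 : Matrix (Tor M) (Tor M) ℂ) + QsOpTw N M ω * (toronOp (fine N M) c m2 ω)⁻¹ * kingQadjTw N M ω) := by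
  rw [noisePlusSandwich_eq_spectral N M hc hm hω]
  refine IsUnit.of_mul_eq_one ((dft M)ᴴ * Matrix.diagonal (fun q => ((a : ℂ)⁻¹ + sigTw N M c m2 ω q)⁻¹) * dft M) ?_
  calc (dft M)ᴴ * Matrix.diagonal (fun q => (a : ℂ)⁻¹ + sigTw N M c m2 ω q) * dft M * ((dft M)ᴴ * Matrix.diagonal (fun q => ((a : ℂ)⁻¹ + sigTw N M c m2 ω q)⁻¹) * dft M)
      = (dft M)ᴴ * (Matrix.diagonal (fun q => (a : ℂ)⁻¹ + sigTw N M c m2 ω q) * (dft M * (dft M)ᴴ) * Matrix.diagonal (fun q => ((a : ℂ)⁻¹ + sigTw N M c m2 ω q)⁻¹)) * dft M := by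
        simp only [Matrix.mul_assoc]
    _ = 1 := by
        rw [dft_mul_conjTranspose, Matrix.mul_one, Matrix.diagonal_mul_diagonal]
        have : (fun i => ((a : ℂ)⁻¹ + sigTw N M c m2 ω i) * ((a : ℂ)⁻¹ + sigTw N M c m2 ω i)⁻¹) = fun _ => 1 :=
          funext fun i => mul_inv_cancel₀ (inv_add_sigTw_ne_zero N M c ha hm ω i)
        rw [this, Matrix.diagonal_one, Matrix.mul_one, dft_conjTranspose_mul]

/-- ★★★ **THE BLOCK-FIELD COVARIANCE AT A TORON**: `(Δ^ω_eff)⁻¹ = a⁻¹·1 + Q^ω·B_ω⁻¹·Q^{ω*}` — the covariance of the `k`-fold block field under King's Gaussian block-spin transformation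
with covariant averaging is the block-spin white noise (holonomy-blind) plus the covariantly block-averaged toron covariance (`a > 0`, `m² > 0`, `c ≥ 0`, unit `ω`).
[cite: King1986, (2.13)-(2.15) p.653, (4.44) p.675; Balaban1985BackgroundPropagators, (3.19) p.393] -/
theorem effLapTw_inv_eq_noise_add_blockAvg {a c m2 : ℝ} (ha : 0 < a) (hc : 0 ≤ c) (hm : 0 < m2) {ω : Fin (d + 1) → ℂ} (hω : ∀ μ, ‖ω μ‖ = 1) :
    (effLapTw N M a c m2 ω)⁻¹ = ((a : ℂ)⁻¹) • (1 : Matrix (Tor M) (Tor M) ℂ) + QsOpTw N M ω * (toronOp (fine N M) c m2 ω)⁻¹ * kingQadjTw N M ω := by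
  rw [effLapTw_eq_inv N M ha hc hm hω]
  exact Matrix.nonsing_inv_nonsing_inv _ ((Matrix.isUnit_iff_isUnit_det _).mp (isUnit_noisePlusSandwich N M ha hc hm hω))

/-- `Δ^ω_eff` is invertible (`a > 0`, `m² > 0`, `c ≥ 0`, unit `ω`). [folklore] -/
theorem isUnit_effLapTw {a c m2 : ℝ} (ha : 0 < a) (hc : 0 ≤ c) (hm : 0 < m2) {ω : Fin (d + 1) → ℂ} (hω : ∀ μ, ‖ω μ‖ = 1) : IsUnit (effLapTw N M a c m2 ω) := by
  rw [effLapTw_eq_inv N M ha hc hm hω]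
  obtain ⟨u, hu⟩ := isUnit_noisePlusSandwich N M ha hc hm hω
  rw [← hu, ← Matrix.coe_units_inv]
  exact Units.isUnit _

/-- ★★ The block-field covariance is the Fourier multiplier `a⁻¹ + sigTw(p′)`: `((Δ^ω_eff)⁻¹g)^(p′) = (a⁻¹ + sigTw(p′))·ĝ(p′)`. [cite: King1986, (4.5) p.670, (2.15) p.653] -/
theorem dft_effLapTw_inv_apply {a c m2 : ℝ} (ha : 0 < a) (hc : 0 ≤ c) (hm : 0 < m2) {ω : Fin (d + 1) → ℂ} (hω : ∀ μ, ‖ω μ‖ = 1) (g : Tor M → ℂ) (q : Tor M) :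
    (dft M *ᵥ ((effLapTw N M a c m2 ω)⁻¹ *ᵥ g)) q = ((a : ℂ)⁻¹ + sigTw N M c m2 ω q) * (dft M *ᵥ g) q := by
  have hmat : dft M * (effLapTw N M a c m2 ω)⁻¹ = Matrix.diagonal (fun q => (a : ℂ)⁻¹ + sigTw N M c m2 ω q) * dft M := by
    rw [effLapTw_inv_eq_noise_add_blockAvg N M ha hc hm hω, noisePlusSandwich_eq_spectral N M hc hm hω, ← Matrix.mul_assoc, ← Matrix.mul_assoc, dft_mul_conjTranspose,
      Matrix.one_mul]
  rw [Matrix.mulVec_mulVec, hmat, ← Matrix.mulVec_mulVec, Matrix.mulVec_diagonal]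

end Inverse

/-! ## §2 The multiplier is King's `composedInvResc a⁻¹ N m²` at the shifted momentum -/
section ByName

/-- THE TORON BLOCK-COVARIANCE SYMBOL at level `k`: `C^{(k)}_ω(p′) := (toronEffSymbol)⁻¹ = composedInvResc a_k⁻¹ L^k m² s′`. [cite: King1986, (4.5) p.670, (4.12) p.671] -/
def toronBlockCovSymbol (a : ℝ) (L k : ℕ) (m2 : ℝ) (φ : Fin (d + 1) → ℝ) (q : Tor M) : ℝ := (toronEffSymbol M a L k m2 φ q)⁻¹

omit hM in
/-- `C^{(k)}_ω(p′) = composedInvResc a_k⁻¹ L^k m² s′ = a_k⁻¹ + Σ_l Ur(s′,l)·Δ^η(s′+l)⁻¹` (King's letters at the shifted momentum). [cite: King1986, (4.5) p.670, (4.12) p.671] -/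
theorem toronBlockCovSymbol_eq (a : ℝ) (L k : ℕ) (m2 : ℝ) (φ : Fin (d + 1) → ℝ) (q : Tor M) :
    toronBlockCovSymbol M a L k m2 φ q = composedInvResc (aK a L k)⁻¹ (L ^ k) m2 (sOfTw (L ^ k) M φ q) := by
  rw [toronBlockCovSymbol, toronEffSymbol, DeltaEff, inv_inv]

/-- ★★ **THE BLOCK-FIELD COVARIANCE AT A TORON, BY NAME**: on the zone of `s′`, `((Δ^{(k)}_ω)⁻¹g)^(p′) = C^{(k)}_ω(p′)·ĝ(p′)` with `C^{(k)}_ω(p′) = composedInvResc a_k⁻¹ L^k m² s′`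
(`a > 0`, `m² > 0`, `L ≥ 2`, `k ≥ 1`, `c = L^{2k}`). [cite: King1986, (2.15) p.653, (4.5) p.670, (4.12) p.671] -/
theorem dft_effLapTw_inv_apply_eq_composedInvResc {a : ℝ} (ha : 0 < a) {L k : ℕ} (hL : 2 ≤ L) (hk : 1 ≤ k) {m2 : ℝ} (hm : 0 < m2) (φ : Fin (d + 1) → ℝ) (g : Tor M → ℂ)
    (q : Tor M) (hzone : ∀ μ, |sOfTw (L ^ k) M φ q μ| ≤ Real.pi) :
    haveI : NeZero (L ^ k) := ⟨pow_ne_zero k (by omega)⟩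
    (dft M *ᵥ ((effLapTw (L ^ k) M (aK a L k) (((L ^ k : ℕ) : ℝ) ^ 2) m2 (twistOf φ))⁻¹ *ᵥ g)) q = ((toronBlockCovSymbol M a L k m2 φ q : ℝ) : ℂ) * (dft M *ᵥ g) q := by
  haveI : NeZero (L ^ k) := ⟨pow_ne_zero k (by omega)⟩
  have hL1 : (1 : ℝ) < L := by exact_mod_cast hL
  have hak := aK_pos ha hL1 hk
  rw [dft_effLapTw_inv_apply (L ^ k) M hak (sq_nonneg _) hm (norm_twistOf_eq_one φ)]
  congr 1
  have h := effLapTw_symbol_eq_DeltaEff (L ^ k) M (aK a L k) m2 φ q hzone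
  have hne : ((aK a L k : ℝ) : ℂ)⁻¹ + sigTw (L ^ k) M (((L ^ k : ℕ) : ℝ) ^ 2) m2 (twistOf φ) q ≠ 0 := inv_add_sigTw_ne_zero (L ^ k) M _ hak hm _ q
  rw [toronBlockCovSymbol, toronEffSymbol, Complex.ofReal_inv, ← h, inv_inv]

omit hM in
/-- ★ `0 < C^{(k)}_ω(p′)` and `a⁻¹ ≤ a_k⁻¹ ≤ C^{(k)}_ω(p′)` (zone, `s′ ≠ 0`, `m² ≥ 0`): the unit-lattice covariance at a toron is bounded BELOW by the block-spin noise, uniformly.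
[cite: King1986, proof of Lemma 4.1 p.671 («Δ^{(k)} ≤ a_k»)] -/
theorem toronBlockCovSymbol_bounds {a : ℝ} (ha : 0 < a) {L k : ℕ} (hL : 2 ≤ L) (hk : 1 ≤ k) {m2 : ℝ} (hm : 0 ≤ m2) (φ : Fin (d + 1) → ℝ) (q : Tor M)
    (hzone : ∀ μ, |sOfTw (L ^ k) M φ q μ| ≤ Real.pi) (hq0 : 0 < momSq (sOfTw (L ^ k) M φ q)) :
    0 < toronBlockCovSymbol M a L k m2 φ q ∧ (aK a L k)⁻¹ ≤ toronBlockCovSymbol M a L k m2 φ q ∧ a⁻¹ ≤ (aK a L k)⁻¹ := by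
  obtain ⟨hpos, hle, hak⟩ := king_prop310_toron_uniform M ha hL hk hm φ q hzone hq0
  refine ⟨inv_pos.mpr hpos, ?_, ?_⟩
  · exact (inv_le_inv₀ (lt_of_lt_of_le hpos hle) hpos).mpr hle
  · have hL1 : (1 : ℝ) < L := by exact_mod_cast hL
    exact (inv_le_inv₀ ha (aK_pos ha hL1 hk)).mpr hak

end ByName

/-! ## §3 The relative `L^{−2k}` rate of the unit-lattice covariance at a toron -/
section Rate

omit hM in
/-- ★★★ **THE UNIT-LATTICE COVARIANCE AT A TORON CONVERGES AT RATE `L^{−2k}`** (relative form, same holonomy at both levels, King's constants): for `L ≥ 2`, `k, n ≥ 1`, `a > 0`,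
`m² ≥ 0`, zone and `s′ ≠ 0`, `|C^{(k)}_ω(p′) − C^{(k+n)}_{ω′}(p′)| ≤ a_k·2(a_n⁻¹ + π²∕48 + 1∕3)·L^{−2k}·C^{(k+n)}_{ω′}(p′)` — King's Lemma 4.3 ∕ (3.91) at `s′` divided by
`Δ^{(k)}_ωΔ^{(k+n)}_{ω′}`; the mode-by-mode shape of King's Lemma 4.5 (4.38). [cite: King1986, Prop. 3.10 (3.91) p.669, Lemma 4.3 (4.18) p.672, Lemma 4.5 (4.38) p.674] -/
theorem king_blockCov_rate_toron {a : ℝ} (ha : 0 < a) {L k n : ℕ} (hL : 2 ≤ L) (hk : 1 ≤ k) (hn : 1 ≤ n) {m2 : ℝ} (hm : 0 ≤ m2) (φ : Fin (d + 1) → ℝ) (q : Tor M)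
    (hzone : ∀ μ, |sOfTw (L ^ k) M φ q μ| ≤ Real.pi) (hq0 : 0 < momSq (sOfTw (L ^ k) M φ q)) :
    |toronBlockCovSymbol M a L k m2 φ q - toronBlockCovSymbol M a L (k + n) m2 (fun μ => φ μ / (L : ℝ) ^ n) q|
      ≤ aK a L k * (2 * (((aK a L n)⁻¹ + Real.pi ^ 2 / 48 + 1 / 3) * (((L ^ k : ℕ) : ℝ) ^ 2)⁻¹)) * toronBlockCovSymbol M a L (k + n) m2 (fun μ => φ μ / (L : ℝ) ^ n) q := by
  have h := king_lemma43_toron M ha hL hk hn hm φ q hzone hq0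
  have hx : 0 < toronEffSymbol M a L k m2 φ q := (king_prop310_toron_uniform M ha hL hk hm φ q hzone hq0).1
  have hzone' : ∀ μ, |sOfTw (L ^ (k + n)) M (fun μ => φ μ / (L : ℝ) ^ n) q μ| ≤ Real.pi := fun μ => by
    rw [pow_add, mul_comm (L ^ k) (L ^ n), sOfTw_refine M L k n (by omega)]; exact hzone μ
  have hq0' : 0 < momSq (sOfTw (L ^ (k + n)) M (fun μ => φ μ / (L : ℝ) ^ n) q) := by
    rw [pow_add, mul_comm (L ^ k) (L ^ n), sOfTw_refine M L k n (by omega)]; exact hq0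
  have hy : 0 < toronEffSymbol M a L (k + n) m2 (fun μ => φ μ / (L : ℝ) ^ n) q := (king_prop310_toron_uniform M ha hL (by omega) hm _ q hzone' hq0').1
  set x := toronEffSymbol M a L k m2 φ q with hxdef
  set y := toronEffSymbol M a L (k + n) m2 (fun μ => φ μ / (L : ℝ) ^ n) q with hydef
  set C := aK a L k * (2 * (((aK a L n)⁻¹ + Real.pi ^ 2 / 48 + 1 / 3) * (((L ^ k : ℕ) : ℝ) ^ 2)⁻¹)) with hC
  have hC0 : 0 ≤ C := by
    have hL1 : (1 : ℝ) < L := by exact_mod_cast hL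
    have := aK_pos ha hL1 hk; have := aK_pos ha hL1 hn; positivity
  unfold toronBlockCovSymbol
  rw [← hxdef, ← hydef]
  have hid : x⁻¹ - y⁻¹ = (y - x) / (x * y) := by field_simp
  rw [hid, abs_div, abs_of_pos (mul_pos hx hy), abs_sub_comm, div_le_iff₀ (mul_pos hx hy)]
  calc |x - y| ≤ C * x := h
    _ = C * y⁻¹ * (x * y) := by field_simp
    _ = _ := by rfl

end Rate

end Summit.QuantumFields.YangMills.BalabanUVNodes.N15KingModelRung.Toron

end
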